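import Summits.AtomisticToContinuum.FouriersLaw.Theorems.HonestZwanzigOpenChainGreenKuboKDN
import Summits.AtomisticToContinuum.FouriersLaw.Theorems.HonestZwanzigFeshbachIdentitiesTimeReversal
import Summits.AtomisticToContinuum.FouriersLaw.Theorems.BondHeatUncertaintyLinearResponseFTURSteadyHeatRatesHelper3

/-!
# Stub `stub_boundaryGreenKubo` of line `cayley-pencil` (crux `ContactStieltjesMeasure.StieltjesRepresentation`,
# stmt-AtomisticToContinuum-15248), part 1: the boundary power, its corrector and the Abel-limit coboundary lemma

Helper file (`--supports stmt-AtomisticToContinuum-15248`). For the pinned anharmonic chain `P = pinnedChain ω₂ lam β γ`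
(`ω₂ > 0`, `lam ≥ 0`, `β, γ > 0`), `N ≥ 2` sites, equal bath temperatures `T > 0`, Gibbs measure `μ_T`, equilibrium kernels
`P_t = transitionKernel N T T t`, total current `J = Σ_i j_i` and the `γ`-FREE BOUNDARY POWER `g₀ = p_0 ∂_{q_0}H`:

* `continuous_boundaryPower`, `abs_boundaryPower_le` — `g₀` is a nice observable (`|g₀| ≤ C e^{ϑH}` for every `ϑ > 0`);
* `pinnedChain_generator_corrector` — the smooth, momentum-even corrector
  `Ψ = X - (N-1) H + (N-1) p_0²/2` (`X = energyMoment`, the energy first moment) has `LΨ = J - (N-1) g₀` pointwise: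
  `L X = J + γ(N-1)(T - p_{N-1}²)` (`pinnedChain_generator_energyMoment`), `L H = γ(T-p_0²) + γ(T-p_{N-1}²)`
  (`generator_hamiltonian_two_baths`), `L(p_0²/2) = -g₀ + γ(T - p_0²)` (`generator_kinetic`); `abs_corrector_le` bounds it;
* `integral_mul_kubo_eq_of_coboundary` — **the Abel-limit coboundary lemma**: if `B = a·g + LΨ` with `A, B, g, Ψ, LΨ` nice,
  `A, B, g` centred and `∫ AΨ dμ_T = 0`, then `∫ A · R₀B dμ_T = a ∫ A · R₀g dμ_T` for the Kubo integrals
  `R₀f = ∫_{(0,∞)} P_t f dt` (resolvent coboundary `R_λ(LΨ) = λR_λΨ - Ψ`, `pinnedChain_resolvent_coboundary`, and the Abel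
  limits `λ → 0`, `pinnedChain_abs_resolvent_sub_kubo_le`, `pinnedChain_abs_abelMean_sub_le`; the bookkeeping of
  `kdn_identity`).

Part 2 derives `∫₀^∞ corr(J,J) = (N-1)² ∫₀^∞ corr(g₀,g₀)` and the stub. No definitions.
-/

noncomputable section

open MeasureTheory ProbabilityTheory Filter Topology Set Function
open scoped NNReal ENNReal ContDiff BigOperators

namespace Summit.AtomisticToContinuum.FouriersLaw.Theorems.ContactStieltjesMeasure.CayleyPencil.BoundaryGreenKubo

open Literature.MathematicalPhysics.KineticTheory.HeatConduction
open Literature.MathematicalPhysics.KineticTheory OscillatorChain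
open Summit.AtomisticToContinuum.FouriersLaw.Theorems.SubdiffusiveBondHeat
open Summit.AtomisticToContinuum.FouriersLaw.Theorems.OddSectorIrreversibility
open Summit.AtomisticToContinuum.FouriersLaw.Theorems.OddSectorIrreversibility.Corrector
open Summit.AtomisticToContinuum.FouriersLaw.Theorems.OpenChainGreenKubo
open Summit.AtomisticToContinuum.FouriersLaw.Theorems.HonestZwanzig
open Literature.Barriers.AtomisticToContinuum.OpenChain

variable {N : ℕ}

/-! ### The boundary power `g₀ = p_0 ∂_{q_0}H` -/

/-- The boundary power `g₀ = p_0 ∂_{q_0}H` of the pinned chain is continuous. [folklore] -/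
theorem continuous_boundaryPower (ω₂ lam β γ : ℝ) (hN : 0 < N) :
    Continuous fun z : PhaseSpace N => z.2 ⟨0, hN⟩ * partialQ ⟨0, hN⟩ ((pinnedChain ω₂ lam β γ).hamiltonian N) z :=
  ((continuous_apply _).comp continuous_snd).mul
    ((pinnedChain ω₂ lam β γ).continuous_partialQ_hamiltonian (pinnedChain_contDiff_hamiltonian ω₂ lam β γ N) _)

/-- **The boundary power is a nice observable**: `|p_0 ∂_{q_0}H| ≤ C e^{ϑH}` for every `ϑ > 0` (`|p_0| ≤ 1 + H`,
`|∂_{q_0}H| ≤ K(1 + H)`, `(1 + H)² ≤ (2e^{ϑ}/ϑ²) e^{ϑH}`). [folklore] -/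
theorem abs_boundaryPower_le {ω₂ lam β γ : ℝ} (hω : 0 < ω₂) (hl : 0 ≤ lam) (hβ : 0 ≤ β) (hγ : 0 ≤ γ) (hN : 0 < N)
    {ϑ : ℝ} (hϑ : 0 < ϑ) :
    ∃ C : ℝ, 0 ≤ C ∧ ∀ y : PhaseSpace N,
      |y.2 ⟨0, hN⟩ * partialQ ⟨0, hN⟩ ((pinnedChain ω₂ lam β γ).hamiltonian N) y| ≤
        C * Real.exp (ϑ * (pinnedChain ω₂ lam β γ).hamiltonian N y) := by
  set P := pinnedChain ω₂ lam β γ with hP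
  have hconf := pinnedChain_isConfining hω hl hβ hγ
  obtain ⟨A, hA0, hA⟩ := hconf.exists_abs_deriv_U_le
  obtain ⟨B, hB0, hB⟩ := hconf.exists_abs_deriv_V_le
  refine ⟨(A + N ^ 2 * B) * (2 * Real.exp ϑ / ϑ ^ 2), by positivity, fun y => ?_⟩
  have hp := LinearResponseFTUR.abs_momentum_le_one_add hconf.U_nonneg hconf.V_nonneg y ⟨0, hN⟩
  have hF := LinearResponseFTUR.abs_partialQ_hamiltonian_le hconf.U_nonneg hconf.V_nonneg hA0 hB0 hA hB
    hconf.differentiable_U hconf.differentiable_V y ⟨0, hN⟩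
  have hsq := pinnedChain_one_add_hamiltonian_sq_le hω hl hβ N (γ := γ) hϑ y
  have hH : 0 ≤ P.hamiltonian N y := pinnedChain_hamiltonian_nonneg hω.le hl hβ γ N y
  rw [abs_mul]
  calc |y.2 ⟨0, hN⟩| * |partialQ ⟨0, hN⟩ (P.hamiltonian N) y|
      ≤ (1 + P.hamiltonian N y) * ((A + N ^ 2 * B) * (1 + P.hamiltonian N y)) :=
        mul_le_mul hp hF (abs_nonneg _) (by positivity)
    _ = (A + N ^ 2 * B) * (1 + P.hamiltonian N y) ^ 2 := by ring
    _ ≤ (A + N ^ 2 * B) * ((2 * Real.exp ϑ / ϑ ^ 2) * Real.exp (ϑ * P.hamiltonian N y)) :=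
        mul_le_mul_of_nonneg_left hsq (by positivity)
    _ = _ := by ring

/-! ### The corrector `Ψ = X - (N-1)H + (N-1)p_0²/2` -/

/-- **`LΨ = J - (N-1) g₀`** for `Ψ = X - (N-1) H + (N-1) p_0²/2` (`N ≥ 2`, both baths at `T`): the bath terms cancel
(`G X = γ(N-1)(T-p_{N-1}²)`, `G H = γ(T-p_0²) + γ(T-p_{N-1}²)`, `G(p_0²/2) = γ(T-p_0²)`) and the Liouville parts are
`A X = J`, `A H = 0`, `A(p_0²/2) = -p_0∂_{q_0}H = -g₀`. [cite: KunduDharNarayan2009, eq. (reln3)] -/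
theorem pinnedChain_generator_corrector {ω₂ lam β γ : ℝ} (hN : 2 ≤ N) (T : ℝ) (x : PhaseSpace N) :
    (pinnedChain ω₂ lam β γ).generator N T T (fun y : PhaseSpace N =>
        energyMoment (pinnedChain ω₂ lam β γ) N y + (-((N : ℝ) - 1)) * (pinnedChain ω₂ lam β γ).hamiltonian N y +
          ((N : ℝ) - 1) * (y.2 ⟨0, by omega⟩ ^ 2 / 2)) x =
      (∑ i : Fin N, (pinnedChain ω₂ lam β γ).bondCurrent N i x) -
        ((N : ℝ) - 1) * (x.2 ⟨0, by omega⟩ * partialQ ⟨0, by omega⟩ ((pinnedChain ω₂ lam β γ).hamiltonian N) x) := by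
  set P := pinnedChain ω₂ lam β γ with hP
  have hU : ContDiff ℝ ∞ P.U := pinnedChain_contDiff_U ω₂ lam β γ
  have hV : ContDiff ℝ ∞ P.V := pinnedChain_contDiff_V ω₂ lam β γ
  have hX2 : ContDiff ℝ 2 (energyMoment P N) := (contDiff_energyMoment P hU hV N).of_le (by norm_cast)
  have hH2 : ContDiff ℝ 2 (fun y => (-((N : ℝ) - 1)) * P.hamiltonian N y) :=
    contDiff_const.mul ((P.contDiff_hamiltonian hU hV N).of_le (by norm_cast))
  have hK2 : ContDiff ℝ 2 (fun y : PhaseSpace N => ((N : ℝ) - 1) * (y.2 ⟨0, by omega⟩ ^ 2 / 2)) :=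
    contDiff_const.mul ((((contDiff_apply ℝ ℝ (⟨0, by omega⟩ : Fin N)).comp contDiff_snd).pow 2).div_const 2)
  have hXH2 : ContDiff ℝ 2 (fun y => energyMoment P N y + (-((N : ℝ) - 1)) * P.hamiltonian N y) := hX2.add hH2
  rw [generator_add P N T T hXH2 hK2, generator_add P N T T hX2 hH2, generator_const_mul, generator_const_mul,
    OddSectorIrreversibility.pinnedChain_generator_energyMoment hN T x,
    Literature.Barriers.AtomisticToContinuum.generator_hamiltonian_two_baths P hN T T x,
    LinearResponseFTUR.generator_kinetic P T T ⟨0, by omega⟩ x]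
  have hγ' : P.γ = γ := rfl
  have h0 : ((⟨0, by omega⟩ : Fin N).val = 0) := rfl
  have h1 : ¬ ((⟨0, by omega⟩ : Fin N).val = N - 1) := by
    show ¬ ((0 : ℕ) = N - 1)
    omega
  rw [if_pos h0, if_neg h1, hγ']
  ring

/-- **The corrector is nice**: `|X - (N-1)H + (N-1)p_0²/2| ≤ 4N · (2e^{ϑ}/ϑ²) e^{ϑH}` (`|X| ≤ 2N H`, `p_0² ≤ 2H`,
`H ≤ (1+H)²`). [folklore] -/
theorem abs_corrector_le {ω₂ lam β : ℝ} (hω : 0 < ω₂) (hl : 0 ≤ lam) (hβ : 0 ≤ β) (γ : ℝ) (hN : 2 ≤ N) {ϑ : ℝ}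
    (hϑ : 0 < ϑ) (y : PhaseSpace N) :
    |energyMoment (pinnedChain ω₂ lam β γ) N y + (-((N : ℝ) - 1)) * (pinnedChain ω₂ lam β γ).hamiltonian N y +
        ((N : ℝ) - 1) * (y.2 ⟨0, by omega⟩ ^ 2 / 2)| ≤
      (4 * N * (2 * Real.exp ϑ / ϑ ^ 2)) * Real.exp (ϑ * (pinnedChain ω₂ lam β γ).hamiltonian N y) := by
  set H := (pinnedChain ω₂ lam β γ).hamiltonian N y with hH
  have hH0 : 0 ≤ H := pinnedChain_hamiltonian_nonneg hω.le hl hβ γ N y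
  have hX := pinnedChain_abs_energyMoment_le hω hl hβ N (γ := γ) y
  have hp := pinnedChain_sq_momentum_le hω hl hβ N (γ := γ) y ⟨0, by omega⟩
  have hsq := pinnedChain_one_add_hamiltonian_sq_le hω hl hβ N (γ := γ) hϑ y
  have hN1 : (1 : ℝ) ≤ (N : ℝ) - 1 := by
    have : (2 : ℝ) ≤ N := by exact_mod_cast hN
    linarith
  have hN1' : (0 : ℝ) ≤ (N : ℝ) - 1 := by linarith
  have e1 : |(-((N : ℝ) - 1)) * H| = ((N : ℝ) - 1) * H := by
    rw [abs_mul, abs_neg, abs_of_nonneg hN1', abs_of_nonneg hH0]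
  have e2 : |((N : ℝ) - 1) * (y.2 ⟨0, by omega⟩ ^ 2 / 2)| ≤ ((N : ℝ) - 1) * H := by
    rw [abs_mul, abs_of_nonneg hN1', abs_of_nonneg (by positivity)]
    exact mul_le_mul_of_nonneg_left (by linarith) hN1'
  have h1 : |energyMoment (pinnedChain ω₂ lam β γ) N y + (-((N : ℝ) - 1)) * H +
      ((N : ℝ) - 1) * (y.2 ⟨0, by omega⟩ ^ 2 / 2)| ≤ 4 * N * H := by
    calc _ ≤ |energyMoment (pinnedChain ω₂ lam β γ) N y + (-((N : ℝ) - 1)) * H| +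
          |((N : ℝ) - 1) * (y.2 ⟨0, by omega⟩ ^ 2 / 2)| := abs_add_le _ _
      _ ≤ |energyMoment (pinnedChain ω₂ lam β γ) N y| + |(-((N : ℝ) - 1)) * H| +
          |((N : ℝ) - 1) * (y.2 ⟨0, by omega⟩ ^ 2 / 2)| := add_le_add (abs_add_le _ _) le_rfl
      _ ≤ 2 * N * H + ((N : ℝ) - 1) * H + ((N : ℝ) - 1) * H := by
          rw [e1]; exact add_le_add (add_le_add hX le_rfl) e2
      _ ≤ 4 * N * H := by nlinarith
  have hH1 : H ≤ (1 + H) ^ 2 := by nlinarith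
  calc _ ≤ 4 * N * H := h1
    _ ≤ 4 * N * (1 + H) ^ 2 := mul_le_mul_of_nonneg_left hH1 (by positivity)
    _ ≤ 4 * N * ((2 * Real.exp ϑ / ϑ ^ 2) * Real.exp (ϑ * H)) := mul_le_mul_of_nonneg_left hsq (by positivity)
    _ = _ := by ring

/-! ### The Abel-limit coboundary lemma -/

section Pinned

variable {ω₂ lam β γ : ℝ} (hω : 0 < ω₂) (hl : 0 ≤ lam) (hβ : 0 < β) (hγ : 0 < γ) (hN : 2 ≤ N)
  {T : ℝ} (hT : 0 < T)
include hω hl hβ hγ hN hT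

/-- **Abel-limit coboundary lemma.** Let `A, B, g` be nice (`0 < ϑ`, `2ϑ < 1/T`) and centred, `Ψ ∈ C²` with `Ψ, LΨ`
nice, `B = a·g + LΨ` pointwise and `∫ AΨ dμ_T = 0`. Then the Kubo integrals `R₀f(z) = ∫_{(0,∞)} P_t f(z) dt` satisfy
`∫ A·R₀B dμ_T = a ∫ A·R₀g dμ_T`. Proof: for `λ > 0`, `R_λB = aR_λg + R_λ(LΨ) = aR_λg + λR_λΨ - Ψ` `μ_T`-a.e.
(`pinnedChain_resolvent_coboundary`), so `∫ A R_λB = a∫ A R_λ g + λ∫ A R_λΨ`; as `λ → 0`, `R_λ → R₀` on centred nice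
observables and `λR_λΨ → μ_T(Ψ)` with rate `O(λ)` (`pinnedChain_abs_resolvent_sub_kubo_le`, `pinnedChain_abs_abelMean_sub_le`),
and `μ_T(A) = 0`. [cite: KunduDharNarayan2009, p. 3] -/
theorem integral_mul_kubo_eq_of_coboundary {ϑ : ℝ} (hϑ0 : 0 < ϑ) (h2ϑ : 2 * ϑ < 1 / T)
    {A B g Ψ : PhaseSpace N → ℝ} (hA : Continuous A) (hB : Continuous B) (hg : Continuous g)
    (hΨ : ContDiff ℝ 2 Ψ) {CA CB Cg CΨ CL : ℝ} (hCB : 0 ≤ CB) (hCg : 0 ≤ Cg)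
    (hCΨ : 0 ≤ CΨ) (hCL : 0 ≤ CL)
    (hAb : ∀ y, |A y| ≤ CA * Real.exp (ϑ * (pinnedChain ω₂ lam β γ).hamiltonian N y))
    (hBb : ∀ y, |B y| ≤ CB * Real.exp (ϑ * (pinnedChain ω₂ lam β γ).hamiltonian N y))
    (hgb : ∀ y, |g y| ≤ Cg * Real.exp (ϑ * (pinnedChain ω₂ lam β γ).hamiltonian N y))
    (hΨb : ∀ y, |Ψ y| ≤ CΨ * Real.exp (ϑ * (pinnedChain ω₂ lam β γ).hamiltonian N y))
    (hLb : ∀ y, |(pinnedChain ω₂ lam β γ).generator N T T Ψ y| ≤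
      CL * Real.exp (ϑ * (pinnedChain ω₂ lam β γ).hamiltonian N y))
    (a : ℝ) (hBeq : ∀ y, B y = a * g y + (pinnedChain ω₂ lam β γ).generator N T T Ψ y)
    (hA0 : ∫ y, A y ∂((pinnedChain ω₂ lam β γ).gibbsMeasure N T) = 0)
    (hB0 : ∫ y, B y ∂((pinnedChain ω₂ lam β γ).gibbsMeasure N T) = 0)
    (hg0 : ∫ y, g y ∂((pinnedChain ω₂ lam β γ).gibbsMeasure N T) = 0)
    (hAΨ : ∫ y, A y * Ψ y ∂((pinnedChain ω₂ lam β γ).gibbsMeasure N T) = 0) :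
    ∫ z, A z * (∫ t in Ioi (0 : ℝ), ∫ y, B y ∂((pinnedChain ω₂ lam β γ).transitionKernel N T T t.toNNReal z))
        ∂((pinnedChain ω₂ lam β γ).gibbsMeasure N T) =
      a * ∫ z, A z * (∫ t in Ioi (0 : ℝ), ∫ y, g y ∂((pinnedChain ω₂ lam β γ).transitionKernel N T T t.toNNReal z))
        ∂((pinnedChain ω₂ lam β γ).gibbsMeasure N T) := by
  set P := pinnedChain ω₂ lam β γ with hP
  set μ := P.gibbsMeasure N T with hμ
  have hN0 : 0 < N := by omega
  haveI : IsProbabilityMeasure μ := pinnedChain_isProbabilityMeasure_gibbsMeasure hω hl hβ.le γ N hT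
  have hϑ1 : ϑ < 1 / T := by linarith
  have hΨc : Continuous Ψ := hΨ.continuous
  -- `LΨ = B - a g` is continuous
  have hLfun : P.generator N T T Ψ = fun y => B y - a * g y := funext fun y => by rw [hBeq y]; ring
  have hLc : Continuous (P.generator N T T Ψ) := by rw [hLfun]; exact hB.sub (continuous_const.mul hg)
  -- Harris constants and the weight `E2 = ∫ e^{2ϑH} dμ_T`
  obtain ⟨K, c, hK, hc, hb⟩ := pinnedChain_harris_bound hω hl hβ hγ hN0 hT hϑ0 hϑ1
  set E2 : ℝ := ∫ z, Real.exp (2 * ϑ * P.hamiltonian N z) ∂μ with hE2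
  -- measurability and bounds of resolvents and Kubo integrals
  have hRm : ∀ (lam' : ℝ) (f : PhaseSpace N → ℝ), Continuous f → StronglyMeasurable fun z =>
      ∫ t in Ioi (0 : ℝ), Real.exp (-(lam' * t)) * ∫ y, f y ∂(P.transitionKernel N T T t.toNNReal z) :=
    fun lam' f hf => pinnedChain_stronglyMeasurable_resolvent hω hl hβ.le hγ.le T T hf.measurable lam'
  have hR0Bm : StronglyMeasurable fun z => ∫ t in Ioi (0 : ℝ), ∫ y, B y ∂(P.transitionKernel N T T t.toNNReal z) :=
    pinnedChain_stronglyMeasurable_kubo hω hl hβ.le hγ.le T T hB.measurable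
  have hR0gm : StronglyMeasurable fun z => ∫ t in Ioi (0 : ℝ), ∫ y, g y ∂(P.transitionKernel N T T t.toNNReal z) :=
    pinnedChain_stronglyMeasurable_kubo hω hl hβ.le hγ.le T T hg.measurable
  have hR0Bb := pinnedChain_abs_kubo_le hω hl hβ hγ hb hc hB hCB hBb hB0
  have hR0gb := pinnedChain_abs_kubo_le hω hl hβ hγ hb hc hg hCg hgb hg0
  -- the exact identity at `λ > 0`: `∫ A R_λ B = a ∫ A R_λ g + λ ∫ A R_λ Ψ`
  have hE : ∀ lam' : ℝ, 0 < lam' →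
      ∫ z, A z * (∫ t in Ioi (0 : ℝ), Real.exp (-(lam' * t)) * ∫ y, B y ∂(P.transitionKernel N T T t.toNNReal z)) ∂μ =
        a * ∫ z, A z * (∫ t in Ioi (0 : ℝ), Real.exp (-(lam' * t)) * ∫ y, g y ∂(P.transitionKernel N T T t.toNNReal z)) ∂μ +
          lam' * ∫ z, A z * (∫ t in Ioi (0 : ℝ), Real.exp (-(lam' * t)) *
            ∫ y, Ψ y ∂(P.transitionKernel N T T t.toNNReal z)) ∂μ := by
    intro lam' hlam
    have hagc : Continuous fun y => a * g y := continuous_const.mul hg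
    have hagb := abs_const_mul_le_exp_bound a hgb
    have hBfun : B = fun y => a * g y + P.generator N T T Ψ y := funext hBeq
    have h2 : ∀ z, (∫ t in Ioi (0 : ℝ), Real.exp (-(lam' * t)) * ∫ y, B y ∂(P.transitionKernel N T T t.toNNReal z)) =
        a * (∫ t in Ioi (0 : ℝ), Real.exp (-(lam' * t)) * ∫ y, g y ∂(P.transitionKernel N T T t.toNNReal z)) +
          (∫ t in Ioi (0 : ℝ), Real.exp (-(lam' * t)) *
            ∫ y, P.generator N T T Ψ y ∂(P.transitionKernel N T T t.toNNReal z)) := by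
      intro z
      rw [hBfun, pinnedChain_resolvent_add hω hl hβ hγ hN0 hT hϑ0 hϑ1 hagc hLc (by positivity) hCL hagb hLb hlam z,
        pinnedChain_resolvent_const_mul]
    have h3 := pinnedChain_resolvent_coboundary hω hl hβ hγ hN hT hϑ0 h2ϑ hΨ hCΨ hCL hΨb hLb hlam
    have hI1 := integrable_nice_mul_resolvent hω hl hβ hγ hT hN0 hϑ0 h2ϑ hA hLc hCL hAb hLb hlam
    have hI2 := integrable_nice_mul_resolvent hω hl hβ hγ hT hN0 hϑ0 h2ϑ hA hg hCg hAb hgb hlam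
    have hI3 := integrable_nice_mul_resolvent hω hl hβ hγ hT hN0 hϑ0 h2ϑ hA hΨc hCΨ hAb hΨb hlam
    have hI4 : Integrable (fun z => A z * Ψ z) μ :=
      (integrable_nice_mul_of_abs_le_exp hω hl hβ hT h2ϑ hA hΨc.stronglyMeasurable hAb hΨb).1
    have h4 : ∫ z, A z * (∫ t in Ioi (0 : ℝ), Real.exp (-(lam' * t)) *
        ∫ y, P.generator N T T Ψ y ∂(P.transitionKernel N T T t.toNNReal z)) ∂μ =
        lam' * ∫ z, A z * (∫ t in Ioi (0 : ℝ), Real.exp (-(lam' * t)) *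
          ∫ y, Ψ y ∂(P.transitionKernel N T T t.toNNReal z)) ∂μ := by
      have e : ∫ z, A z * (∫ t in Ioi (0 : ℝ), Real.exp (-(lam' * t)) *
          ∫ y, P.generator N T T Ψ y ∂(P.transitionKernel N T T t.toNNReal z)) ∂μ =
          ∫ z, (lam' * (A z * (∫ t in Ioi (0 : ℝ), Real.exp (-(lam' * t)) *
            ∫ y, Ψ y ∂(P.transitionKernel N T T t.toNNReal z))) - A z * Ψ z) ∂μ := by
        refine integral_congr_ae (h3.mono fun z hz => ?_)
        simp only at hz ⊢
        rw [hz]; ring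
      rw [e, integral_sub (hI3.const_mul _) hI4, integral_const_mul, hAΨ, sub_zero]
    have h5 : ∫ z, A z * (∫ t in Ioi (0 : ℝ), Real.exp (-(lam' * t)) * ∫ y, B y ∂(P.transitionKernel N T T t.toNNReal z)) ∂μ =
        ∫ z, (a * (A z * (∫ t in Ioi (0 : ℝ), Real.exp (-(lam' * t)) * ∫ y, g y ∂(P.transitionKernel N T T t.toNNReal z))) +
          A z * (∫ t in Ioi (0 : ℝ), Real.exp (-(lam' * t)) *
            ∫ y, P.generator N T T Ψ y ∂(P.transitionKernel N T T t.toNNReal z))) ∂μ :=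
      integral_congr_ae (Eventually.of_forall fun z => by simp only; rw [h2 z]; ring)
    rw [h5, integral_add (hI2.const_mul _) hI1, integral_const_mul, h4]
  -- the `O(λ)` estimate
  have hD : ∀ lam' : ℝ, 0 < lam' →
      |(∫ z, A z * (∫ t in Ioi (0 : ℝ), ∫ y, B y ∂(P.transitionKernel N T T t.toNNReal z)) ∂μ) -
        a * ∫ z, A z * (∫ t in Ioi (0 : ℝ), ∫ y, g y ∂(P.transitionKernel N T T t.toNNReal z)) ∂μ| ≤
        (CA * (K * CB / c ^ 2) * E2 + |a| * (CA * (K * Cg / c ^ 2) * E2) + CA * (K * CΨ / c) * E2) * lam' := by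
    intro lam' hlam
    have hW1b : ∀ z, |(∫ t in Ioi (0 : ℝ), Real.exp (-(lam' * t)) * ∫ y, B y ∂(P.transitionKernel N T T t.toNNReal z)) -
        ∫ t in Ioi (0 : ℝ), ∫ y, B y ∂(P.transitionKernel N T T t.toNNReal z)| ≤
        lam' * (K * CB / c ^ 2) * Real.exp (ϑ * P.hamiltonian N z) := fun z =>
      (pinnedChain_abs_resolvent_sub_kubo_le hω hl hβ hγ hϑ0 hb hc hB hCB hBb hB0 hlam z).trans_eq (by ring)
    have hW2b : ∀ z, |(∫ t in Ioi (0 : ℝ), Real.exp (-(lam' * t)) * ∫ y, g y ∂(P.transitionKernel N T T t.toNNReal z)) -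
        ∫ t in Ioi (0 : ℝ), ∫ y, g y ∂(P.transitionKernel N T T t.toNNReal z)| ≤
        lam' * (K * Cg / c ^ 2) * Real.exp (ϑ * P.hamiltonian N z) := fun z =>
      (pinnedChain_abs_resolvent_sub_kubo_le hω hl hβ hγ hϑ0 hb hc hg hCg hgb hg0 hlam z).trans_eq (by ring)
    have hW3b : ∀ z, |lam' * (∫ t in Ioi (0 : ℝ), Real.exp (-(lam' * t)) *
        ∫ y, Ψ y ∂(P.transitionKernel N T T t.toNNReal z)) - ∫ y, Ψ y ∂μ| ≤
        lam' * (K * CΨ / c) * Real.exp (ϑ * P.hamiltonian N z) := fun z =>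
      (pinnedChain_abs_abelMean_sub_le hω hl hβ hγ hϑ0 hb hc hΨc hCΨ hΨb hlam z).trans_eq (by ring)
    have d1 := integrable_nice_mul_of_abs_le_exp hω hl hβ hT h2ϑ hA ((hRm lam' B hB).sub hR0Bm) hAb hW1b
    have d2 := integrable_nice_mul_of_abs_le_exp hω hl hβ hT h2ϑ hA ((hRm lam' g hg).sub hR0gm) hAb hW2b
    have d3 := integrable_nice_mul_of_abs_le_exp hω hl hβ hT h2ϑ hA
      (((hRm lam' Ψ hΨc).const_mul lam').sub stronglyMeasurable_const) hAb hW3b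
    have iB1 := integrable_nice_mul_resolvent hω hl hβ hγ hT hN0 hϑ0 h2ϑ hA hB hCB hAb hBb hlam
    have iB0 := (integrable_nice_mul_of_abs_le_exp hω hl hβ hT h2ϑ hA hR0Bm hAb (D := K * CB / c)
      (fun z => (hR0Bb z).trans_eq (by ring))).1
    have ig1 := integrable_nice_mul_resolvent hω hl hβ hγ hT hN0 hϑ0 h2ϑ hA hg hCg hAb hgb hlam
    have ig0 := (integrable_nice_mul_of_abs_le_exp hω hl hβ hT h2ϑ hA hR0gm hAb (D := K * Cg / c)
      (fun z => (hR0gb z).trans_eq (by ring))).1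
    have iΨ1 := integrable_nice_mul_resolvent hω hl hβ hγ hT hN0 hϑ0 h2ϑ hA hΨc hCΨ hAb hΨb hlam
    have hAi : Integrable A μ := pinnedChain_integrable_nice hω hl hβ hT hϑ1 hA hAb
    -- single-integral forms of the three differences
    have e1 : (∫ z, A z * (∫ t in Ioi (0 : ℝ), Real.exp (-(lam' * t)) * ∫ y, B y ∂(P.transitionKernel N T T t.toNNReal z)) ∂μ) -
        ∫ z, A z * (∫ t in Ioi (0 : ℝ), ∫ y, B y ∂(P.transitionKernel N T T t.toNNReal z)) ∂μ =
        ∫ z, A z * ((∫ t in Ioi (0 : ℝ), Real.exp (-(lam' * t)) * ∫ y, B y ∂(P.transitionKernel N T T t.toNNReal z)) -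
          ∫ t in Ioi (0 : ℝ), ∫ y, B y ∂(P.transitionKernel N T T t.toNNReal z)) ∂μ := by
      rw [← integral_sub iB1 iB0]
      exact integral_congr_ae (Eventually.of_forall fun z => by ring)
    have e2 : (∫ z, A z * (∫ t in Ioi (0 : ℝ), Real.exp (-(lam' * t)) * ∫ y, g y ∂(P.transitionKernel N T T t.toNNReal z)) ∂μ) -
        ∫ z, A z * (∫ t in Ioi (0 : ℝ), ∫ y, g y ∂(P.transitionKernel N T T t.toNNReal z)) ∂μ =
        ∫ z, A z * ((∫ t in Ioi (0 : ℝ), Real.exp (-(lam' * t)) * ∫ y, g y ∂(P.transitionKernel N T T t.toNNReal z)) -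
          ∫ t in Ioi (0 : ℝ), ∫ y, g y ∂(P.transitionKernel N T T t.toNNReal z)) ∂μ := by
      rw [← integral_sub ig1 ig0]
      exact integral_congr_ae (Eventually.of_forall fun z => by ring)
    have e3 : lam' * ∫ z, A z * (∫ t in Ioi (0 : ℝ), Real.exp (-(lam' * t)) *
        ∫ y, Ψ y ∂(P.transitionKernel N T T t.toNNReal z)) ∂μ =
        ∫ z, A z * (lam' * (∫ t in Ioi (0 : ℝ), Real.exp (-(lam' * t)) *
          ∫ y, Ψ y ∂(P.transitionKernel N T T t.toNNReal z)) - ∫ y, Ψ y ∂μ) ∂μ := by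
      have e : (fun z => A z * (lam' * (∫ t in Ioi (0 : ℝ), Real.exp (-(lam' * t)) *
          ∫ y, Ψ y ∂(P.transitionKernel N T T t.toNNReal z)) - ∫ y, Ψ y ∂μ)) =
          fun z => lam' * (A z * (∫ t in Ioi (0 : ℝ), Real.exp (-(lam' * t)) *
            ∫ y, Ψ y ∂(P.transitionKernel N T T t.toNNReal z))) - (∫ y, Ψ y ∂μ) * A z := by
        funext z; ring
      rw [e, integral_sub (iΨ1.const_mul _) (hAi.const_mul _), integral_const_mul, integral_const_mul, hA0,
        mul_zero, sub_zero]
    -- combine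
    have hEl := hE lam' hlam
    set X0 := ∫ z, A z * (∫ t in Ioi (0 : ℝ), ∫ y, B y ∂(P.transitionKernel N T T t.toNNReal z)) ∂μ with hX0
    set X1 := ∫ z, A z * (∫ t in Ioi (0 : ℝ), Real.exp (-(lam' * t)) * ∫ y, B y ∂(P.transitionKernel N T T t.toNNReal z)) ∂μ
      with hX1
    set Y0 := ∫ z, A z * (∫ t in Ioi (0 : ℝ), ∫ y, g y ∂(P.transitionKernel N T T t.toNNReal z)) ∂μ with hY0
    set Y1 := ∫ z, A z * (∫ t in Ioi (0 : ℝ), Real.exp (-(lam' * t)) * ∫ y, g y ∂(P.transitionKernel N T T t.toNNReal z)) ∂μ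
      with hY1
    set Z1 := ∫ z, A z * (∫ t in Ioi (0 : ℝ), Real.exp (-(lam' * t)) * ∫ y, Ψ y ∂(P.transitionKernel N T T t.toNNReal z)) ∂μ
      with hZ1
    have hDeq : X0 - a * Y0 = -(X1 - X0) + a * (Y1 - Y0) + lam' * Z1 := by rw [hEl]; ring
    have b1 : |X1 - X0| ≤ CA * (lam' * (K * CB / c ^ 2)) * E2 := by rw [e1]; exact d1.2
    have b2 : |Y1 - Y0| ≤ CA * (lam' * (K * Cg / c ^ 2)) * E2 := by rw [e2]; exact d2.2
    have b3 : |lam' * Z1| ≤ CA * (lam' * (K * CΨ / c)) * E2 := by rw [e3]; exact d3.2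
    rw [hDeq]
    calc |-(X1 - X0) + a * (Y1 - Y0) + lam' * Z1|
        ≤ |-(X1 - X0) + a * (Y1 - Y0)| + |lam' * Z1| := abs_add_le _ _
      _ ≤ |-(X1 - X0)| + |a * (Y1 - Y0)| + |lam' * Z1| := add_le_add (abs_add_le _ _) le_rfl
      _ = |X1 - X0| + |a| * |Y1 - Y0| + |lam' * Z1| := by rw [abs_neg, abs_mul]
      _ ≤ CA * (lam' * (K * CB / c ^ 2)) * E2 + |a| * (CA * (lam' * (K * Cg / c ^ 2)) * E2) +
            CA * (lam' * (K * CΨ / c)) * E2 := by gcongr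
      _ = _ := by ring
  have hD0 := eq_zero_of_abs_le_mul_eps fun ε hε => hD ε hε
  exact sub_eq_zero.1 hD0

end Pinned

/-- **Registered sub-goal `stub_boundaryGreenKubo_kuboCoboundary`** (= `integral_mul_kubo_eq_of_coboundary` with all
binders explicit): the Abel-limit coboundary lemma `∫ A·R₀B dμ_T = a ∫ A·R₀g dμ_T` for `B = a·g + LΨ`, `A, B, g` centred
nice, `Ψ` a smooth nice corrector with `∫ AΨ dμ_T = 0`. [cite: KunduDharNarayan2009, p. 3] -/
theorem stub_boundaryGreenKubo_kuboCoboundary :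
    ∀ (N : ℕ) (ω₂ lam β γ : ℝ), 0 < ω₂ → 0 ≤ lam → 0 < β → 0 < γ → 2 ≤ N → ∀ T : ℝ, 0 < T →
    ∀ ϑ : ℝ, 0 < ϑ → 2 * ϑ < 1 / T → ∀ (A B g Ψ : PhaseSpace N → ℝ), Continuous A → Continuous B → Continuous g →
    ContDiff ℝ 2 Ψ → ∀ (CA CB Cg CΨ CL : ℝ), 0 ≤ CB → 0 ≤ Cg → 0 ≤ CΨ → 0 ≤ CL →
    (∀ y, |A y| ≤ CA * Real.exp (ϑ * (pinnedChain ω₂ lam β γ).hamiltonian N y)) →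
    (∀ y, |B y| ≤ CB * Real.exp (ϑ * (pinnedChain ω₂ lam β γ).hamiltonian N y)) →
    (∀ y, |g y| ≤ Cg * Real.exp (ϑ * (pinnedChain ω₂ lam β γ).hamiltonian N y)) →
    (∀ y, |Ψ y| ≤ CΨ * Real.exp (ϑ * (pinnedChain ω₂ lam β γ).hamiltonian N y)) →
    (∀ y, |(pinnedChain ω₂ lam β γ).generator N T T Ψ y| ≤ CL * Real.exp (ϑ * (pinnedChain ω₂ lam β γ).hamiltonian N y)) →
    ∀ a : ℝ, (∀ y, B y = a * g y + (pinnedChain ω₂ lam β γ).generator N T T Ψ y) →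
    (∫ y, A y ∂((pinnedChain ω₂ lam β γ).gibbsMeasure N T)) = 0 →
    (∫ y, B y ∂((pinnedChain ω₂ lam β γ).gibbsMeasure N T)) = 0 →
    (∫ y, g y ∂((pinnedChain ω₂ lam β γ).gibbsMeasure N T)) = 0 →
    (∫ y, A y * Ψ y ∂((pinnedChain ω₂ lam β γ).gibbsMeasure N T)) = 0 →
    (∫ z, A z * (∫ t in Set.Ioi (0 : ℝ), ∫ y, B y ∂((pinnedChain ω₂ lam β γ).transitionKernel N T T t.toNNReal z))
      ∂((pinnedChain ω₂ lam β γ).gibbsMeasure N T)) =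
    a * ∫ z, A z * (∫ t in Set.Ioi (0 : ℝ), ∫ y, g y ∂((pinnedChain ω₂ lam β γ).transitionKernel N T T t.toNNReal z))
      ∂((pinnedChain ω₂ lam β γ).gibbsMeasure N T) :=
  fun _N _ω₂ _lam _β _γ hω hl hβ hγ hN _T hT _ϑ hϑ0 h2ϑ _A _B _g _Ψ hA hB hg hΨ _CA _CB _Cg _CΨ _CL hCB hCg hCΨ hCL
      hAb hBb hgb hΨb hLb a hBeq hA0 hB0 hg0 hAΨ =>
    integral_mul_kubo_eq_of_coboundary hω hl hβ hγ hN hT hϑ0 h2ϑ hA hB hg hΨ hCB hCg hCΨ hCL hAb hBb hgb hΨb hLb a hBeq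
      hA0 hB0 hg0 hAΨ

end Summit.AtomisticToContinuum.FouriersLaw.Theorems.ContactStieltjesMeasure.CayleyPencil.BoundaryGreenKubo

end
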